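import Literature.Geometry.Riemannian.MetricFlowConcentration
import Mathlib.MeasureTheory.Measure.LevyProkhorovMetric
import HarnessLib

/-!
# The Lévy–Prokhorov distance is bounded by the square root of the `W₁`-distance

R. Bamler, *Compactness theory of the space of super Ricci flows*, Invent. Math. 233 (2023), §2.4
(after the Theorem that `(𝕄, d_{GW_p})` is complete): *"Since the Prokhorov distance is bounded by
the `W₁`-Wasserstein distance, `GW₁`-convergence implies convergence in the Gromov–Prokhorov
sense"*. The classical quantitative form (e.g. Gibbs–Su 2002, Thm. 2: `d_P² ≤ d_W`) is: for
probability measures `μ, ν` on a separable metric space, `d_{LP}(μ, ν) ≤ √(d_{W₁}(μ, ν))` —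
for a coupling `q` and a Borel set `B`, `μ(B) = q(B × X) ≤ q(X × B_ε) + q(d ≥ ε) ≤ ν(B_ε) + ∫ d dq / ε`
(Markov). We prove it for Mathlib's `MeasureTheory.levyProkhorovEDist` and the tree's
`wassersteinW1` (`MetricFlowConcentration.lean`), which is the bridge from `W₁`-estimates of
metric flows to Mathlib's weak convergence of probability measures
(`MeasureTheory.LevyProkhorov`, Prokhorov's theorem):

* `measure_le_measure_thickening_add_of_isCoupling` — the coupling/Markov estimate;
* `levyProkhorovEDist_le_sqrt_wassersteinW1` — **`d_{LP} ≤ d_{W₁}^{1/2}`**;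
* `ProbabilityMeasure.tendsto_of_tendsto_wassersteinW1` — `W₁`-convergence implies weak
  convergence (convergence in `MeasureTheory.ProbabilityMeasure X`).

Everything is proved; no definitions, no named facts.

## References

* R. H. Bamler, *Compactness theory of the space of super Ricci flows*, Invent. Math. 233 (2023),
  §2.4 (remark after the Theorem: the Prokhorov distance is bounded by `W₁`). [Bamler2023]
* C. Villani, *Topics in Optimal Transportation*, GSM 58 (AMS 2003), §7.1 (Wasserstein
  distances metrize weak convergence). [Villani2003]
-/

noncomputable section

open Set MeasureTheory Filter Metric
open scoped Topology ENNReal NNReal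

namespace Literature.Geometry.Riemannian

variable {X : Type*} [MetricSpace X] [MeasurableSpace X] [BorelSpace X] [SecondCountableTopology X]

/-- **The coupling estimate behind `d_{LP} ≤ √d_{W₁}`**: for a coupling `q` of `μ, ν`, a
measurable `B` and `0 < ε < ∞`,
`μ(B) ≤ ν(B_ε) + (∫ d dq)/ε` — since `B × X ⊆ (X × B_ε) ∪ {d ≥ ε}` up to the coupling, and
`q(d ≥ ε) ≤ ∫ d dq / ε` (Markov). [folklore] -/
theorem measure_le_measure_thickening_add_of_isCoupling {μ ν : Measure X} {q : Measure (X × X)}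
    (hq : IsCoupling μ ν q) {B : Set X} (hB : MeasurableSet B) {ε : ℝ≥0∞} (hε0 : ε ≠ 0)
    (hεtop : ε ≠ ∞) :
    μ B ≤ ν (thickening ε.toReal B) + (∫⁻ p, edist p.1 p.2 ∂q) / ε := by
  obtain ⟨hqP, hq1, hq2⟩ := hq
  have hT : MeasurableSet (thickening ε.toReal B) := isOpen_thickening.measurableSet
  calc μ B = q (Prod.fst ⁻¹' B) := by rw [← hq1, Measure.fst_apply hB]
    _ ≤ q (Prod.snd ⁻¹' thickening ε.toReal B ∪ {p | ε ≤ edist p.1 p.2}) := by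
        refine measure_mono fun p hp ↦ ?_
        by_cases h : edist p.1 p.2 < ε
        · refine Or.inl ?_
          rw [mem_preimage, mem_thickening_iff_exists_edist_lt]
          exact ⟨p.1, hp, by rwa [ENNReal.ofReal_toReal hεtop, edist_comm]⟩
        · exact Or.inr (not_lt.1 h)
    _ ≤ q (Prod.snd ⁻¹' thickening ε.toReal B) + q {p | ε ≤ edist p.1 p.2} := measure_union_le _ _
    _ ≤ ν (thickening ε.toReal B) + (∫⁻ p, edist p.1 p.2 ∂q) / ε := by
        refine add_le_add (le_of_eq ?_) (meas_ge_le_lintegral_div measurable_edist.aemeasurable hε0 hεtop)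
        rw [← hq2, Measure.snd_apply hT]

/-- **The Lévy–Prokhorov distance is bounded by the square root of the `W₁`-distance**
(Bamler 2023, §2.4: *"the Prokhorov distance is bounded by the `W₁`-Wasserstein distance"*;
classically `d_P² ≤ d_W`): for probability measures on a separable metric space,
`d_{LP}(μ, ν) ≤ d_{W₁}(μ, ν)^{1/2}` — for every `ε > d_{W₁}^{1/2}` there is a coupling of cost
`< ε²`, and then `μ(B) ≤ ν(B_ε) + ε`, `ν(B) ≤ μ(B_ε) + ε` for all Borel `B`
(`measure_le_measure_thickening_add_of_isCoupling`).
[cite: Bamler2023, §2.4 (remark after the Theorem: Prokhorov distance bounded by W₁)] -/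
theorem levyProkhorovEDist_le_sqrt_wassersteinW1 (μ ν : Measure X) [IsProbabilityMeasure μ]
    [IsProbabilityMeasure ν] :
    levyProkhorovEDist μ ν ≤ (wassersteinW1 μ ν) ^ (1 / 2 : ℝ) := by
  refine levyProkhorovEDist_le_of_forall μ ν _ fun ε B hδε hεtop hB ↦ ?_
  have hε0 : ε ≠ 0 := (lt_of_le_of_lt zero_le hδε).ne'
  -- a coupling of cost `< ε²`
  have hW : wassersteinW1 μ ν < ε ^ 2 := by
    have h1 : (wassersteinW1 μ ν ^ (1 / 2 : ℝ)) ^ 2 < ε ^ 2 := ENNReal.pow_lt_pow_left two_ne_zero hδε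
    rwa [← ENNReal.rpow_natCast, ← ENNReal.rpow_mul, show (1 / 2 : ℝ) * ((2 : ℕ) : ℝ) = 1 by norm_num,
      ENNReal.rpow_one] at h1
  obtain ⟨⟨q, hq⟩, hcost⟩ := iInf_lt_iff.1 hW
  have hdiv : (∫⁻ p, edist p.1 p.2 ∂q) / ε ≤ ε :=
    ENNReal.div_le_of_le_mul (by rw [← pow_two]; exact hcost.le)
  -- the swapped coupling, for the second inequality
  have hq' : IsCoupling ν μ (q.map Prod.swap) := by
    obtain ⟨hqP, hq1, hq2⟩ := hq
    haveI := hqP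
    exact ⟨Measure.isProbabilityMeasure_map measurable_swap.aemeasurable,
      by rw [Measure.fst_map_swap]; exact hq2, by rw [Measure.snd_map_swap]; exact hq1⟩
  have hcost' : ∫⁻ p, edist p.1 p.2 ∂(q.map Prod.swap) = ∫⁻ p, edist p.1 p.2 ∂q := by
    rw [lintegral_map measurable_edist measurable_swap]
    simp_rw [Prod.fst_swap, Prod.snd_swap, edist_comm]
  constructor
  · exact (measure_le_measure_thickening_add_of_isCoupling hq hB hε0 hεtop.ne).trans
      (add_le_add le_rfl hdiv)
  · refine (measure_le_measure_thickening_add_of_isCoupling hq' hB hε0 hεtop.ne).trans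
      (add_le_add le_rfl ?_)
    rwa [hcost']

/-- **`W₁`-convergence implies weak convergence** (Bamler 2023, §2.4: `GW₁`/`W₁`-convergence
implies (Gromov–)Prokhorov convergence; Villani 2003, §7.1): if
`d_{W₁}(μᵢ, μ) → 0` along a filter then `μᵢ → μ` in `ProbabilityMeasure X` (the topology of weak
convergence) — through `levyProkhorovEDist_le_sqrt_wassersteinW1` and the continuity of the
identity from the Lévy–Prokhorov metric to the topology of weak convergence
(`MeasureTheory.LevyProkhorov.continuous_toMeasure_probabilityMeasure`).
[cite: Bamler2023, §2.4 (remark after the Theorem: Prokhorov distance bounded by W₁)] -/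
theorem ProbabilityMeasure.tendsto_of_tendsto_wassersteinW1 {ι : Type*} {l : Filter ι}
    {μs : ι → ProbabilityMeasure X} {μ : ProbabilityMeasure X}
    (h : Tendsto (fun i ↦ wassersteinW1 (μs i : Measure X) (μ : Measure X)) l (𝓝 0)) :
    Tendsto μs l (𝓝 μ) := by
  -- `d_{LP}(μᵢ, μ) → 0`
  have hsqrt : Tendsto (fun i ↦ (wassersteinW1 (μs i : Measure X) (μ : Measure X)) ^ (1 / 2 : ℝ))
      l (𝓝 0) := by
    have hc := (ENNReal.continuous_rpow_const (y := (1 / 2 : ℝ))).tendsto (0 : ℝ≥0∞)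
    rw [ENNReal.zero_rpow_of_pos (by norm_num : (0 : ℝ) < 1 / 2)] at hc
    exact hc.comp h
  have hLP : Tendsto (fun i ↦ levyProkhorovEDist (μs i : Measure X) (μ : Measure X)) l (𝓝 0) :=
    tendsto_of_tendsto_of_tendsto_of_le_of_le tendsto_const_nhds hsqrt (fun _ ↦ zero_le)
      fun i ↦ levyProkhorovEDist_le_sqrt_wassersteinW1 _ _
  -- convergence for the Lévy–Prokhorov metric, then weak convergence
  have hconv : Tendsto (fun i ↦ LevyProkhorov.ofMeasure (μs i)) l
      (𝓝 (LevyProkhorov.ofMeasure μ)) := by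
    rw [EMetric.tendsto_nhds]
    intro ε hε
    filter_upwards [(tendsto_order.1 hLP).2 ε hε] with i hi
    rw [LevyProkhorov.edist_probabilityMeasure_def]
    exact hi
  exact (LevyProkhorov.continuous_toMeasure_probabilityMeasure.tendsto
    (LevyProkhorov.ofMeasure μ)).comp hconv

end Literature.Geometry.Riemannian

end
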